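import Literature.NumberTheory.Automorphic.PrincipalSeriesGL2SatakeParametersLastBlock
import Literature.NumberTheory.Automorphic.HeckeOperatorTensorTrivial
import HarnessLib

/-!
# The Hecke operators `T₁, T₂` act by scalars on ALL `GL₂(𝒪)`-fixed vectors of an unramified principal series

Topic `Literature/NumberTheory/Automorphic`; proof file (theorems only: no definition, no named fact, no instance).
Sequel to `PrincipalSeriesGL2SatakeParameters` (`isSatakeParameter_parabolicIndGL_fin_two`: the spherical vector of
`I(σ) = Ind_B^{GL₂}(σ ⊗ δ^{1/2})`, `σ` acting through unramified `χ₁, χ₂` on the diagonal, is a `T₁, T₂`-eigenvector with eigenvalues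
`q^{1/2}(χ₁(ϖ)+χ₂(ϖ))`, `χ₁(ϖ)χ₂(ϖ)`), which records the `∃`-form `IsSatakeParameter`.  Consumers that read Hecke
operators on the fixed vectors of a GLOBAL space (the d6 line of cell hodgecm-mathlib: `T_w, S_w` on `ω(μ,ε,χ)^K` through the
local theta quotient at a split place) need the `∀`-form: EVERY `GL₂(𝒪)`-fixed vector is an eigenvector with these
eigenvalues.  For `I(σ)` this is the same computation (Cartier §IV (3.3)/(4.2): `(T_r f)(1)` only involves `f(1)`, and a fixed
`f` is determined by `f(1)`), done here for an arbitrary fixed `f` — and WITHOUT the unramifiedness hypotheses (for ramified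
`χ_i` there is no non-zero fixed vector and the `∀`-statements are vacuous):

* `heckeT_apply_of_mem_fixedPoints_parabolicIndGL_fin_two` — `∀ f ∈ I(σ)^{GL₂(𝒪)}`,
  `T₁ f = q^{1/2}(χ₁(ϖ)+χ₂(ϖ)) • f` and `T₂ f = χ₁(ϖ)χ₂(ϖ) • f`;
* `heckeT_apply_of_mem_fixedPoints_parabolicIndGL_lastBlockLabel_two` — the same in the `Q_{(1,1)}`-labelling
  `lastBlockLabel 2` with Levi character `maxParabolicLeviChar F 2 ν χ` (transport along
  `parabolicIndGL_lastBlockLabel_two_equiv`, `heckeOperator_apply_eq_smul_of_equiv`);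
* `heckeT_apply_of_mem_fixedPoints_of_equiv_parabolicIndGL_lastBlockLabel_two` — the same for ANY representation `Θ`
  of `GL₂(F)` isomorphic to `Ind_{Q_{(1,1)}}((ν∘det) ⊠ χ′ν^{1-2})` (the split-place oscillator currency):
  `T₁ x = q^{1/2}(ν(ϖ) + χ′(ϖ)ν(ϖ)⁻¹) • x`, `T₂ x = χ′(ϖ) • x` for every `x ∈ Θ^{GL₂(𝒪)}`.

## References

* P. Cartier, *Representations of 𝔭-adic groups: a survey*, PSPM 33 (1979), part 1, §IV (3.3), (4.2).
  [CartierCorvallis1979]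
* D. Bump, *Automorphic forms and representations* (1997), Prop. 4.6.6. [Bump1997]
-/

noncomputable section

open scoped MatrixGroups NNReal
open ValuativeRel Finset

namespace Literature.NumberTheory.Automorphic

open GaloisRepresentations.IsNonarchimedeanLocalField (normAbs residueFieldCard residueFieldCard_ne_zero)
open Zelevinsky1980 (lastBlockLabel maxParabolicLeviChar)

section HeckeEigenvalues

variable {F : Type*} [Field F] [ValuativeRel F] [TopologicalSpace F] [IsNonarchimedeanLocalField F]
variable {W : Type*} [AddCommGroup W] [Module ℂ W]
  (σ : Representation ℂ (Π a, GL {i // (id : Fin 2 → Fin 2) i = a} F) W)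

omit [ValuativeRel F] [TopologicalSpace F] [IsNonarchimedeanLocalField F] in
/-- `ϖ^ε = diag(ϖ^{ε₀}, ϖ^{ε₁}) ∈ B`. [folklore] -/
private theorem piPowGL_mem_standardParabolicGL_fin_two' {ϖ : F} (hϖ : ϖ ≠ 0) (ε : Fin 2 → ℕ) :
    piPowGL hϖ ε ∈ standardParabolicGL F (id : Fin 2 → Fin 2) := by
  rw [mem_standardParabolicGL_iff, coe_piPowGL]
  intro i j hij
  rw [Echelon.piPow_apply, if_neg]
  rintro rfl
  exact lt_irrefl _ hij

/-- the pivot sets of size `1` in `Fin 2`. [folklore] -/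
private theorem filter_card_eq_one_fin_two' :
    ((Finset.univ : Finset (Finset (Fin 2))).filter fun S => S.card = 2 - 1) = { {0}, {1} } := by decide

/-- `c({0}) = 0`. [folklore] -/
private theorem card_echelonPositions_singleton_zero' : (echelonPositions ({0} : Finset (Fin 2))).card = 0 := by
  decide

/-- `c({1}) = 1`. [folklore] -/
private theorem card_echelonPositions_singleton_one' : (echelonPositions ({1} : Finset (Fin 2))).card = 1 := by
  decide

/-- `ε_{{0}} = (0, 1)`. [folklore] -/
private theorem epsOf_singleton_zero' : epsOf ({0} : Finset (Fin 2)) = ![0, 1] := by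
  funext i; fin_cases i <;> rfl

/-- `ε_{{1}} = (1, 0)`. [folklore] -/
private theorem epsOf_singleton_one' : epsOf ({1} : Finset (Fin 2)) = ![1, 0] := by
  funext i; fin_cases i <;> rfl

/-- **`T₁` and `T₂` act by `q^{1/2}(χ₁(ϖ)+χ₂(ϖ))` and `χ₁(ϖ)χ₂(ϖ)` on EVERY `GL₂(𝒪)`-fixed vector of the normalised
principal series `I(σ)`** (`σ` acting on `W` through characters `χ₁, χ₂` on the diagonal — no unramifiedness needed:
for ramified `χ_i` the fixed space is `0` and the statement is vacuous).  Same computation as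
`isSatakeParameter_parabolicIndGL_fin_two` (Cartier §IV (3.3): `(T_r f)(1) = ∑_{(S,ā)} f(u_a ϖ^{ε_S})`, each term a multiple of
`f(1)`; a fixed `f` is determined by `f(1)`), run for an arbitrary fixed `f` instead of the spherical vector.
[cite: CartierCorvallis1979, §IV (4.2)] [cite: Bump1997, Prop. 4.6.6] -/
theorem heckeT_apply_of_mem_fixedPoints_parabolicIndGL_fin_two (χ₁ χ₂ : Fˣ →* ℂˣ)
    (hσ : ∀ (u v : Fˣ) (w : W), σ (leviProjection F (id : Fin 2 → Fin 2)
      ⟨diagGL2 u v, diagGL2_mem_standardParabolicGL_fin_two u v⟩) w = ((χ₁ u * χ₂ v : ℂˣ) : ℂ) • w)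
    {ϖ : F} (hϖ : IsUniformizingElement ϖ)
    {f : Representation.SmoothInd (standardParabolicGL F (id : Fin 2 → Fin 2))
      (Representation.twist (MonoidHom.comp σ (leviProjection F (id : Fin 2 → Fin 2)))
        (rootDeltaChar (standardParabolicGL F (id : Fin 2 → Fin 2))))}
    (hf : f ∈ (Representation.parabolicIndGL F (id : Fin 2 → Fin 2) σ).fixedPoints (glInt 2 F)) :
    heckeT (Representation.parabolicIndGL F (id : Fin 2 → Fin 2) σ) (Units.mk0 ϖ hϖ.ne_zero) 1 f =
        ((Real.sqrt (residueFieldCard F) : ℂ) *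
          (((χ₁ (Units.mk0 ϖ hϖ.ne_zero) : ℂˣ) : ℂ) + ((χ₂ (Units.mk0 ϖ hϖ.ne_zero) : ℂˣ) : ℂ))) • f ∧
      heckeT (Representation.parabolicIndGL F (id : Fin 2 → Fin 2) σ) (Units.mk0 ϖ hϖ.ne_zero) 2 f =
        (((χ₁ (Units.mk0 ϖ hϖ.ne_zero) : ℂˣ) : ℂ) * ((χ₂ (Units.mk0 ϖ hϖ.ne_zero) : ℂˣ) : ℂ)) • f := by
  classical
  set ϖu : Fˣ := Units.mk0 ϖ hϖ.ne_zero with hϖu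
  have hnϖ : normAbs F ϖ = (residueFieldCard F : ℝ≥0)⁻¹ := normAbs_eq_inv_of_isUniformizingElement hϖ
  -- the value of the inducing datum at `ϖ^{(k,l)}`
  have hval : ∀ (k l : ℕ) (hd : piPowGL hϖ.ne_zero ![k, l] ∈ standardParabolicGL F (id : Fin 2 → Fin 2)) (w : W),
      (Representation.twist (MonoidHom.comp σ (leviProjection F (id : Fin 2 → Fin 2)))
          (rootDeltaChar (standardParabolicGL F (id : Fin 2 → Fin 2)))) ⟨piPowGL hϖ.ne_zero ![k, l], hd⟩ w =
        (((NNReal.sqrt (normAbs F (ϖ ^ k / ϖ ^ l)) : ℝ≥0) : ℝ) : ℂ) •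
          ((χ₁ ϖu ^ k * χ₂ ϖu ^ l : ℂˣ) : ℂ) • w := by
    intro k l hd w
    have hd' : diagGL2 (ϖu ^ k) (ϖu ^ l) ∈ standardParabolicGL F (id : Fin 2 → Fin 2) :=
      diagGL2_mem_standardParabolicGL_fin_two _ _
    have he : (⟨piPowGL hϖ.ne_zero ![k, l], hd⟩ : ↥(standardParabolicGL F (id : Fin 2 → Fin 2))) =
        ⟨diagGL2 (ϖu ^ k) (ϖu ^ l), hd'⟩ := Subtype.ext (piPowGL_fin_two hϖ.ne_zero k l)
    rw [he, twist_diagGL2_apply σ χ₁ χ₂ hσ, map_pow, map_pow]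
    simp [hϖu]
  -- finiteness of the orbits `K t_r K / K`
  have hfin : ∀ {r : ℕ}, r ≤ 2 →
      (MulAction.orbit (glInt 2 F) ((heckeDiag 2 ϖu r : GL (Fin 2) F) : GL (Fin 2) F ⧸ glInt 2 F)).Finite := by
    intro r hr
    rw [← (bijOn_heckeTransversal (n := 2) hϖ hr).image_eq]
    exact (Finset.finite_toSet _).image _
  -- scalar bookkeeping
  haveI : Fintype 𝓀[F] := Fintype.ofFinite _
  have hqcard : (Fintype.card 𝓀[F] : ℂ) = (residueFieldCard F : ℂ) := by
    rw [residueFieldCard, Nat.card_eq_fintype_card]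
  have hqR : ((residueFieldCard F : ℝ≥0) : ℝ) = (residueFieldCard F : ℝ) := by norm_cast
  have hsqrt : ((NNReal.sqrt (residueFieldCard F : ℝ≥0) : ℝ≥0) : ℝ) = Real.sqrt (residueFieldCard F) := by
    rw [Real.coe_sqrt, hqR]
  have hsq : Real.sqrt (residueFieldCard F) * Real.sqrt (residueFieldCard F) = (residueFieldCard F : ℝ) :=
    Real.mul_self_sqrt (Nat.cast_nonneg _)
  have hsqrt0 : (Real.sqrt (residueFieldCard F) : ℂ) ≠ 0 := by
    have : (0 : ℝ) < Real.sqrt (residueFieldCard F) :=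
      Real.sqrt_pos.2 (by exact_mod_cast Nat.pos_of_ne_zero (residueFieldCard_ne_zero F))
    exact_mod_cast this.ne'
  have hn01 : normAbs F (ϖ ^ 0 / ϖ ^ 1) = (residueFieldCard F : ℝ≥0) := by
    rw [pow_zero, pow_one, one_div, map_inv₀, hnϖ, inv_inv]
  have hn10 : normAbs F (ϖ ^ 1 / ϖ ^ 0) = (residueFieldCard F : ℝ≥0)⁻¹ := by
    rw [pow_one, pow_zero, div_one, hnϖ]
  have hn11 : normAbs F (ϖ ^ 1 / ϖ ^ 1) = 1 := by
    rw [div_self (pow_ne_zero _ hϖ.ne_zero), map_one]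
  refine ⟨?_, ?_⟩
  · -- `T₁`: `(T₁ f)(1) = (1 · √q χ₂(ϖ) + q · √q⁻¹ χ₁(ϖ)) f(1)`
    have hT1fix : heckeT (Representation.parabolicIndGL F (id : Fin 2 → Fin 2) σ) ϖu 1 f ∈
        (Representation.parabolicIndGL F (id : Fin 2 → Fin 2) σ).fixedPoints (glInt 2 F) := by
      rw [heckeT_def]
      exact heckeOperator_apply_mem_fixedPoints _ _ _ hf (hfin (by norm_num))
    refine apply_eq_smul_of_toFun_one_eq σ hf _ hT1fix _ ?_
    rw [toFun_one_heckeT_eq_sum σ hϖ (by norm_num) hf]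
    simp_rw [toFun_rep_eq σ hϖ hf]
    rw [sum_transversalIndex_of_fst (n := 2) (F := F) 1 (fun S =>
      (Representation.twist (MonoidHom.comp σ (leviProjection F (id : Fin 2 → Fin 2)))
        (rootDeltaChar (standardParabolicGL F (id : Fin 2 → Fin 2))))
        ⟨piPowGL hϖ.ne_zero (epsOf S), piPowGL_mem_standardParabolicGL_fin_two' hϖ.ne_zero _⟩ (f.toFun 1)),
      filter_card_eq_one_fin_two', Finset.sum_pair (by decide), card_echelonPositions_singleton_zero',
      card_echelonPositions_singleton_one', pow_zero, pow_one, one_smul]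
    have hA := hval 0 1 (epsOf_singleton_zero' ▸ piPowGL_mem_standardParabolicGL_fin_two' hϖ.ne_zero _)
      (f.toFun 1)
    have hB := hval 1 0 (epsOf_singleton_one' ▸ piPowGL_mem_standardParabolicGL_fin_two' hϖ.ne_zero _)
      (f.toFun 1)
    have hA' : (Representation.twist (MonoidHom.comp σ (leviProjection F (id : Fin 2 → Fin 2)))
        (rootDeltaChar (standardParabolicGL F (id : Fin 2 → Fin 2))))
        ⟨piPowGL hϖ.ne_zero (epsOf ({0} : Finset (Fin 2))), piPowGL_mem_standardParabolicGL_fin_two' hϖ.ne_zero _⟩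
          (f.toFun 1) =
        (((NNReal.sqrt (normAbs F (ϖ ^ 0 / ϖ ^ 1)) : ℝ≥0) : ℝ) : ℂ) •
          ((χ₁ ϖu ^ 0 * χ₂ ϖu ^ 1 : ℂˣ) : ℂ) • f.toFun 1 := by
      rw [← hA]; congr 2; exact Subtype.ext (congrArg (piPowGL hϖ.ne_zero) epsOf_singleton_zero')
    have hB' : (Representation.twist (MonoidHom.comp σ (leviProjection F (id : Fin 2 → Fin 2)))
        (rootDeltaChar (standardParabolicGL F (id : Fin 2 → Fin 2))))
        ⟨piPowGL hϖ.ne_zero (epsOf ({1} : Finset (Fin 2))), piPowGL_mem_standardParabolicGL_fin_two' hϖ.ne_zero _⟩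
          (f.toFun 1) =
        (((NNReal.sqrt (normAbs F (ϖ ^ 1 / ϖ ^ 0)) : ℝ≥0) : ℝ) : ℂ) •
          ((χ₁ ϖu ^ 1 * χ₂ ϖu ^ 0 : ℂˣ) : ℂ) • f.toFun 1 := by
      rw [← hB]; congr 2; exact Subtype.ext (congrArg (piPowGL hϖ.ne_zero) epsOf_singleton_one')
    rw [hA', hB', hn01, hn10, NNReal.sqrt_inv, NNReal.coe_inv, hsqrt, ← Nat.cast_smul_eq_nsmul ℂ,
      hqcard, smul_smul, smul_smul, smul_smul, ← add_smul]
    congr 1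
    push_cast
    simp only [pow_zero, pow_one, one_mul, mul_one]
    have hq : (residueFieldCard F : ℂ) = (Real.sqrt (residueFieldCard F) : ℂ) * Real.sqrt (residueFieldCard F) := by
      exact_mod_cast hsq.symm
    rw [hq]
    field_simp
    ring
  · -- `T₂ = I(ϖ · 1)` on fixed vectors
    rw [heckeT_self_apply _ ϖu hf]
    have hzfix : (Representation.parabolicIndGL F (id : Fin 2 → Fin 2) σ) (heckeDiag 2 ϖu 2) f ∈
        (Representation.parabolicIndGL F (id : Fin 2 → Fin 2) σ).fixedPoints (glInt 2 F) := by
      rw [Representation.mem_fixedPoints]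
      intro k hk
      rw [← Module.End.mul_apply, ← map_mul, mul_heckeDiag_self_comm, map_mul, Module.End.mul_apply,
        ((Representation.parabolicIndGL F (id : Fin 2 → Fin 2) σ).mem_fixedPoints _ f).1 hf k hk]
    refine apply_eq_smul_of_toFun_one_eq σ hf _ hzfix _ ?_
    have hz : heckeDiag 2 ϖu 2 = piPowGL hϖ.ne_zero ![1, 1] := by
      rw [heckeDiag_two_two, piPowGL_fin_two, pow_one]
    have hC := hval 1 1 (hz ▸ hz.symm ▸ piPowGL_mem_standardParabolicGL_fin_two' hϖ.ne_zero _) (f.toFun 1)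
    rw [parabolicIndGL_fin_two_apply, Representation.toFun_smoothIndRep_apply, one_mul,
      show heckeDiag 2 ϖu 2 = ((⟨piPowGL hϖ.ne_zero ![1, 1], piPowGL_mem_standardParabolicGL_fin_two' hϖ.ne_zero _⟩ :
        ↥(standardParabolicGL F (id : Fin 2 → Fin 2))) : GL (Fin 2) F) * 1 by rw [mul_one]; exact hz,
      toFun_borel_mul_of_mem_fixedPoints σ hf _ (Subgroup.one_mem _), hC, hn11, NNReal.sqrt_one,
      NNReal.coe_one, Complex.ofReal_one, one_smul, pow_one, pow_one, Units.val_mul]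

/-- **The same in the `Q_{(1,1)}`-labelling `lastBlockLabel 2`** (Levi character `maxParabolicLeviChar F 2 ν χ` twisting the
trivial representation on `ℂ`): for every `GL₂(𝒪)`-fixed `x`,
`T₁ x = q^{1/2}(ν(ϖ)+χ(ϖ)) • x` and `T₂ x = ν(ϖ)χ(ϖ) • x` (transport along `parabolicIndGL_lastBlockLabel_two_equiv`).
[cite: CartierCorvallis1979, §IV (4.2)] [cite: Bump1997, Prop. 4.6.6] -/
theorem heckeT_apply_of_mem_fixedPoints_parabolicIndGL_lastBlockLabel_two (ν χ : Fˣ →* ℂˣ)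
    {ϖ : F} (hϖ : IsUniformizingElement ϖ) {x}
    (hx : x ∈ (Representation.parabolicIndGL F (lastBlockLabel 2)
        ((Representation.trivial ℂ (Π a : Bool, GL {i : Fin 2 // lastBlockLabel 2 i = a} F) ℂ).twist
          (maxParabolicLeviChar F 2 ν χ))).fixedPoints (glInt 2 F)) :
    heckeT (Representation.parabolicIndGL F (lastBlockLabel 2)
        ((Representation.trivial ℂ (Π a : Bool, GL {i : Fin 2 // lastBlockLabel 2 i = a} F) ℂ).twist
          (maxParabolicLeviChar F 2 ν χ))) (Units.mk0 ϖ hϖ.ne_zero) 1 x =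
        ((Real.sqrt (residueFieldCard F) : ℂ) *
          (((ν (Units.mk0 ϖ hϖ.ne_zero) : ℂˣ) : ℂ) + ((χ (Units.mk0 ϖ hϖ.ne_zero) : ℂˣ) : ℂ))) • x ∧
      heckeT (Representation.parabolicIndGL F (lastBlockLabel 2)
        ((Representation.trivial ℂ (Π a : Bool, GL {i : Fin 2 // lastBlockLabel 2 i = a} F) ℂ).twist
          (maxParabolicLeviChar F 2 ν χ))) (Units.mk0 ϖ hϖ.ne_zero) 2 x =
        (((ν (Units.mk0 ϖ hϖ.ne_zero) : ℂˣ) : ℂ) * ((χ (Units.mk0 ϖ hϖ.ne_zero) : ℂˣ) : ℂ)) • x := by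
  set ω := (Representation.trivial ℂ (Π a : Bool, GL {i : Fin 2 // lastBlockLabel 2 i = a} F) ℂ).twist
    (maxParabolicLeviChar F 2 ν χ) with hω
  obtain ⟨e⟩ := parabolicIndGL_lastBlockLabel_two_equiv ω
  have hfin : ∀ {r : ℕ}, r ≤ 2 → (MulAction.orbit (glInt 2 F)
      ((heckeDiag 2 (Units.mk0 ϖ hϖ.ne_zero) r : GL (Fin 2) F) : GL (Fin 2) F ⧸ glInt 2 F)).Finite := by
    intro r hr
    rw [← (bijOn_heckeTransversal (n := 2) hϖ hr).image_eq]
    exact (Finset.finite_toSet _).image _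
  -- the relabelled inducing datum acts through `(ν, χ)` on the diagonal (as in `PrincipalSeriesGL2SatakeParametersLastBlock`)
  have h0 : lastBlockLabel 2 (0 : Fin 2) = false := by decide
  have h1 : lastBlockLabel 2 (1 : Fin 2) = true := by decide
  have hσ : ∀ (u v : Fˣ) (w : ℂ), (ω.comp (leviReindexHom F (lastBlockLabel 2) (Equiv.refl (Fin 2))
      (id : Fin 2 → Fin 2) (by decide))) (leviProjection F (id : Fin 2 → Fin 2)
        ⟨diagGL2 u v, diagGL2_mem_standardParabolicGL_fin_two u v⟩) w = ((ν u * χ v : ℂˣ) : ℂ) • w := by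
    intro u v w
    have hdet : ∀ (a : Bool) (i : Fin 2) (_ : lastBlockLabel 2 i = a),
        Matrix.GeneralLinearGroup.det (leviProjection F (lastBlockLabel 2)
          (parabolicReindex F (lastBlockLabel 2) (Equiv.refl (Fin 2)) (id : Fin 2 → Fin 2)
            (by decide) ⟨diagGL2 u v, diagGL2_mem_standardParabolicGL_fin_two u v⟩) a) =
          if i = 0 then u else v := by
      intro a i ha
      subst ha
      haveI : Subsingleton {j : Fin 2 // lastBlockLabel 2 j = lastBlockLabel 2 i} :=
        ⟨fun ⟨j, hj⟩ ⟨j', hj'⟩ => Subtype.ext (by revert hj hj'; revert i j j'; decide)⟩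
      refine Units.ext ?_
      rw [Matrix.GeneralLinearGroup.val_det_apply, Matrix.det_eq_elem_of_subsingleton _ ⟨i, rfl⟩,
        leviProjection_apply_coe, coe_parabolicReindex]
      have hre : ∀ g : GL (Fin 2) F, reindexGL (k := F) (Equiv.refl (Fin 2)) g = g := fun g =>
        Units.ext (by rw [coe_reindexGL]; ext i j; rfl)
      rw [hre, coe_diagGL2]
      fin_cases i <;> simp
    rw [MonoidHom.comp_apply, ← leviProjection_parabolicReindex, hω, Representation.twist_apply,
      Representation.trivial_apply, Zelevinsky1980.maxParabolicLeviChar_apply, hdet false 0 h0, hdet true 1 h1]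
    simp
  have hid := fun {f} (hf : f ∈ _) =>
    heckeT_apply_of_mem_fixedPoints_parabolicIndGL_fin_two _ ν χ hσ hϖ (f := f) hf
  refine ⟨?_, ?_⟩
  · rw [heckeT_def]
    exact heckeOperator_apply_eq_smul_of_equiv (glInt 2 F) e _ (hfin (by norm_num)) _
      (fun y hy => by rw [← heckeT_def]; exact (hid hy).1) hx
  · rw [heckeT_def]
    exact heckeOperator_apply_eq_smul_of_equiv (glInt 2 F) e _ (hfin (by norm_num)) _
      (fun y hy => by rw [← heckeT_def]; exact (hid hy).2) hx

/-- **Split-place form (the isomorphism as a hypothesis)**: for ANY representation `Θ` of `GL₂(F)` isomorphic to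
`Ind_{Q_{(1,1)}}((ν∘det) ⊠ χ′ν^{1-2})`, EVERY `GL₂(𝒪)`-fixed vector `x` of `Θ` satisfies
`T₁ x = q^{1/2}(ν(ϖ) + χ′(ϖ)ν(ϖ)⁻¹) • x` and `T₂ x = χ′(ϖ) • x`. [cite: CartierCorvallis1979, §IV (4.2)] [cite: Bump1997, Prop. 4.6.6] -/
theorem heckeT_apply_of_mem_fixedPoints_of_equiv_parabolicIndGL_lastBlockLabel_two {V : Type*} [AddCommGroup V]
    [Module ℂ V] {Θ : Representation ℂ (GL (Fin 2) F) V} (ν χ' : Fˣ →* ℂˣ)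
    {ϖ : F} (hϖ : IsUniformizingElement ϖ)
    (e : Θ.Equiv (Representation.parabolicIndGL F (lastBlockLabel 2)
      ((Representation.trivial ℂ (Π a : Bool, GL {i : Fin 2 // lastBlockLabel 2 i = a} F) ℂ).twist
        (maxParabolicLeviChar F 2 ν (χ' * ν ^ (1 - ((2 : ℕ) : ℤ)))))))
    {x : V} (hx : x ∈ Θ.fixedPoints (glInt 2 F)) :
    heckeT Θ (Units.mk0 ϖ hϖ.ne_zero) 1 x =
        ((Real.sqrt (residueFieldCard F) : ℂ) *
          (((ν (Units.mk0 ϖ hϖ.ne_zero) : ℂˣ) : ℂ) +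
            ((χ' (Units.mk0 ϖ hϖ.ne_zero) : ℂˣ) : ℂ) * (((ν (Units.mk0 ϖ hϖ.ne_zero) : ℂˣ) : ℂ))⁻¹)) • x ∧
      heckeT Θ (Units.mk0 ϖ hϖ.ne_zero) 2 x = ((χ' (Units.mk0 ϖ hϖ.ne_zero) : ℂˣ) : ℂ) • x := by
  have hfin : ∀ {r : ℕ}, r ≤ 2 → (MulAction.orbit (glInt 2 F)
      ((heckeDiag 2 (Units.mk0 ϖ hϖ.ne_zero) r : GL (Fin 2) F) : GL (Fin 2) F ⧸ glInt 2 F)).Finite := by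
    intro r hr
    rw [← (bijOn_heckeTransversal (n := 2) hϖ hr).image_eq]
    exact (Finset.finite_toSet _).image _
  have hz : ν ^ (1 - ((2 : ℕ) : ℤ)) = ν⁻¹ := by
    rw [show (1 - ((2 : ℕ) : ℤ)) = -1 by norm_num]
    exact zpow_neg_one ν
  have hI := fun {f} (hf : f ∈ _) =>
    heckeT_apply_of_mem_fixedPoints_parabolicIndGL_lastBlockLabel_two ν (χ' * ν ^ (1 - ((2 : ℕ) : ℤ))) hϖ (x := f) hf
  have hval : (((χ' * ν ^ (1 - ((2 : ℕ) : ℤ))) (Units.mk0 ϖ hϖ.ne_zero) : ℂˣ) : ℂ) =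
      ((χ' (Units.mk0 ϖ hϖ.ne_zero) : ℂˣ) : ℂ) * (((ν (Units.mk0 ϖ hϖ.ne_zero) : ℂˣ) : ℂ))⁻¹ := by
    rw [hz, MonoidHom.mul_apply, MonoidHom.inv_apply, Units.val_mul, Units.val_inv_eq_inv_val]
  have hνne : (((ν (Units.mk0 ϖ hϖ.ne_zero) : ℂˣ) : ℂ)) ≠ 0 := Units.ne_zero _
  refine ⟨?_, ?_⟩
  · rw [heckeT_def, ← hval]
    exact heckeOperator_apply_eq_smul_of_equiv (glInt 2 F) e.symm _ (hfin (by norm_num)) _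
      (fun y hy => by rw [← heckeT_def]; exact (hI hy).1) hx
  · have h2 : (((ν (Units.mk0 ϖ hϖ.ne_zero) : ℂˣ) : ℂ)) *
        (((χ' * ν ^ (1 - ((2 : ℕ) : ℤ))) (Units.mk0 ϖ hϖ.ne_zero) : ℂˣ) : ℂ) =
          ((χ' (Units.mk0 ϖ hϖ.ne_zero) : ℂˣ) : ℂ) := by
      rw [hval, mul_comm, mul_assoc, inv_mul_cancel₀ hνne, mul_one]
    rw [heckeT_def, ← h2]
    exact heckeOperator_apply_eq_smul_of_equiv (glInt 2 F) e.symm _ (hfin (by norm_num)) _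
      (fun y hy => by rw [← heckeT_def]; exact (hI hy).2) hx

end HeckeEigenvalues

end Literature.NumberTheory.Automorphic

end
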